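import Mathlib.Analysis.Complex.RemovableSingularity
import Mathlib.Analysis.Complex.CauchyIntegral

/-!
# Stub `stub_leafFloc` of skeleton v15 (crux `WitnessCharge`, stmt-SmoothPoincare4-7824, line
`Sketch`, lead c8) — analytic preliminaries: the one-variable Laurent lemma

Registered helper `helper_leafFloc_laurent` of the stub `stub_leafFloc` (the local family of
pencil members read off from the leaves of the cap model): if `g` is holomorphic on an open set
containing `w₀`, `g w₀ = 0` and `c := g'(w₀) ≠ 0`, then with `e := g''(w₀) / 2`
`(g (w₀ + η))⁻¹ − (c η)⁻¹ → −e / c²` as `η → 0`, `η ≠ 0` — the constant term of the Laurent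
expansion of `1/g` at its simple pole, which is the affine renormalisation constant of the
canonical parametrisation of a pencil member read in the cap chart `t = 1/z`.

Proof: two removable singularities (`dslope`): `g w = (w − w₀) h w`, `h = dslope g w₀`
holomorphic with `h w₀ = c`, and `h w = c + (w − w₀) k w`, `k = dslope h w₀` holomorphic with
`k w₀ = h'(w₀) = g''(w₀)/2`; then for `η ≠ 0`, `h (w₀ + η) ≠ 0`:
`(η h)⁻¹ − (c η)⁻¹ = −k/(c h) → −k(w₀)/c²`.
-/

noncomputable section

set_option linter.dupNamespace false

open scoped Topology
open Set Filter

namespace Summit.SmoothPoincare4.SmoothPoincare4.Theorems.WitnessCharge.PencilIncompleteness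

/-- `g'' (w₀) = 2 (dslope g w₀)'(w₀)` for `g` holomorphic on an open set `s ∋ w₀`: with
`h = dslope g w₀`, `g w = g w₀ + (w − w₀) h w`, so `g' = h + (w − w₀) h'` on `s` and
`g''(w₀) = 2 h'(w₀)`. -/
theorem leafFloc_deriv_deriv_eq_two_mul_deriv_dslope {g : ℂ → ℂ} {s : Set ℂ} {w₀ : ℂ} (hs : IsOpen s)
    (hw₀ : w₀ ∈ s) (hg : DifferentiableOn ℂ g s) :
    deriv (deriv g) w₀ = 2 * deriv (dslope g w₀) w₀ := by
  set h := dslope g w₀ with hh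
  have hsn : s ∈ 𝓝 w₀ := hs.mem_nhds hw₀
  have hhd : DifferentiableOn ℂ h s := (Complex.differentiableOn_dslope hsn).2 hg
  have hh'd : DifferentiableOn ℂ (deriv h) s := (hhd.analyticOnNhd hs).deriv.differentiableOn
  have hgh : ∀ w, g w = g w₀ + (w - w₀) * h w := fun w => by
    have e := sub_smul_dslope g w₀ w
    rw [smul_eq_mul] at e
    rw [hh, e]; ring
  -- `g' = h + (w - w₀) h'` on `s`
  have hderiv : ∀ z ∈ s, deriv g z = h z + (z - w₀) * deriv h z := by
    intro z hz
    have hhz : HasDerivAt h (deriv h z) z := (hhd.differentiableAt (hs.mem_nhds hz)).hasDerivAt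
    have h1 : HasDerivAt (fun w => g w₀ + (w - w₀) * h w) (1 * h z + (z - w₀) * deriv h z) z :=
      (((hasDerivAt_id' z).sub_const w₀).mul hhz).const_add (g w₀)
    have h1' : HasDerivAt g (1 * h z + (z - w₀) * deriv h z) z :=
      h1.congr_of_eventuallyEq (Eventually.of_forall fun w => hgh w)
    rw [h1'.deriv, one_mul]
  have hev : deriv g =ᶠ[𝓝 w₀] fun z => h z + (z - w₀) * deriv h z :=
    Filter.eventuallyEq_of_mem hsn hderiv
  rw [hev.deriv_eq]
  have hq0 : HasDerivAt h (deriv h w₀) w₀ := (hhd.differentiableAt hsn).hasDerivAt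
  have hq'0 : HasDerivAt (deriv h) (deriv (deriv h) w₀) w₀ :=
    (hh'd.differentiableAt hsn).hasDerivAt
  have h2 : HasDerivAt (fun z => h z + (z - w₀) * deriv h z)
      (deriv h w₀ + (1 * deriv h w₀ + (w₀ - w₀) * deriv (deriv h) w₀)) w₀ :=
    hq0.add (((hasDerivAt_id' w₀).sub_const w₀).mul hq'0)
  rw [h2.deriv]
  ring

/-- **Registered helper `helper_leafFloc_laurent` — the one-variable Laurent lemma.** For `g`
holomorphic on an open `s ∋ w₀` with `g w₀ = 0` and `c = g'(w₀) ≠ 0`: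
`(g (w₀ + η))⁻¹ − (c η)⁻¹ → −(g''(w₀)/2) / c²` as `η → 0`, `η ≠ 0` (the constant Laurent
coefficient of `1/g` at the simple pole `w₀`). Proof by two `dslope`s:
`g (w₀ + η) = η h`, `h = c + η k`, so the difference is `−k/(c h) → −k(w₀)/c²`, and
`k w₀ = h'(w₀) = g''(w₀)/2`. -/
theorem helper_leafFloc_laurent :
    ∀ (g : ℂ → ℂ) (s : Set ℂ) (w₀ : ℂ), IsOpen s → w₀ ∈ s → DifferentiableOn ℂ g s → g w₀ = 0 →
      deriv g w₀ ≠ 0 →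
      Filter.Tendsto (fun η : ℂ => (g (w₀ + η))⁻¹ - (deriv g w₀ * η)⁻¹)
        (nhdsWithin (0 : ℂ) {0}ᶜ)
        (nhds (-(deriv (deriv g) w₀ / 2) / (deriv g w₀) ^ 2)) := by
  intro g s w₀ hs hw₀ hg hg0 hc
  set c := deriv g w₀ with hcdef
  set h := dslope g w₀ with hh
  have hsn : s ∈ 𝓝 w₀ := hs.mem_nhds hw₀
  have hhd : DifferentiableOn ℂ h s := (Complex.differentiableOn_dslope hsn).2 hg
  have hh0 : h w₀ = c := by rw [hh, dslope_same]
  have hgh : ∀ w, g w = (w - w₀) * h w := fun w => by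
    have e := sub_smul_dslope g w₀ w
    rw [smul_eq_mul, hg0, sub_zero] at e
    exact e.symm
  set k := dslope h w₀ with hk
  have hkd : DifferentiableOn ℂ k s := (Complex.differentiableOn_dslope hsn).2 hhd
  have hk0 : k w₀ = deriv h w₀ := by rw [hk, dslope_same]
  have hhk : ∀ w, h w = c + (w - w₀) * k w := fun w => by
    have e := sub_smul_dslope h w₀ w
    rw [smul_eq_mul, hh0] at e
    linear_combination -e
  -- the value of the limit
  have hval : -(deriv (deriv g) w₀ / 2) / c ^ 2 = -(k w₀) / (c * c) := by
    rw [hk0, leafFloc_deriv_deriv_eq_two_mul_deriv_dslope hs hw₀ hg]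
    ring
  rw [hval]
  -- continuity of `h`, `k` at `w₀`
  have hsh : Tendsto (fun η : ℂ => w₀ + η) (𝓝 0) (𝓝 w₀) := by
    have e : Tendsto (fun η : ℂ => w₀ + η) (𝓝 0) (𝓝 (w₀ + 0)) :=
      tendsto_const_nhds.add tendsto_id
    rwa [add_zero] at e
  have hH : Tendsto (fun η => h (w₀ + η)) (𝓝 0) (𝓝 c) := by
    rw [← hh0]
    exact ((hhd.differentiableAt hsn).continuousAt.tendsto).comp hsh
  have hK : Tendsto (fun η => k (w₀ + η)) (𝓝 0) (𝓝 (k w₀)) :=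
    ((hkd.differentiableAt hsn).continuousAt.tendsto).comp hsh
  have hlim : Tendsto (fun η => -(k (w₀ + η)) / (c * h (w₀ + η))) (𝓝 0)
      (𝓝 (-(k w₀) / (c * c))) :=
    hK.neg.div (tendsto_const_nhds.mul hH) (mul_ne_zero hc hc)
  have hne : ∀ᶠ η in 𝓝 (0 : ℂ), h (w₀ + η) ≠ 0 := hH.eventually_ne hc
  have heq : (fun η => -(k (w₀ + η)) / (c * h (w₀ + η))) =ᶠ[𝓝[≠] (0 : ℂ)]
      fun η : ℂ => (g (w₀ + η))⁻¹ - (c * η)⁻¹ := by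
    filter_upwards [self_mem_nhdsWithin, mem_nhdsWithin_of_mem_nhds hne] with η hη hhη
    have hη0 : η ≠ 0 := hη
    have e1 : g (w₀ + η) = η * h (w₀ + η) := by rw [hgh (w₀ + η), add_sub_cancel_left]
    have e2 : h (w₀ + η) = c + η * k (w₀ + η) := by rw [hhk (w₀ + η), add_sub_cancel_left]
    rw [e1]
    field_simp
    linear_combination e2
  exact (hlim.mono_left nhdsWithin_le_nhds).congr' heq

end Summit.SmoothPoincare4.SmoothPoincare4.Theorems.WitnessCharge.PencilIncompleteness
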